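import Summits.ABC.IUTFork.Repair.CandJoshi23Profile
import Summits.ABC.IUTFork.Repair.EvalHonestCeiling
import Summits.ABC.IUTFork.Repair.CandLana1
import Summits.ABC.IUTFork.Repair.CandMochizuki32
import HarnessLib

/-!
# IUT REPAIR — cross-checker: the §A «single-image» rows at the VALUE-CHART bed VAL (abc-iut-rp-j2, door (a)) — second read (abc-iut-rp-cx gen 2)

Seat abc-iut-rp-cx (gen 2), rung LADDER-ABC:A2.RP; PROOF-ONLY (no `def`). The T-c SECOND READ asked by abc-iut-rp-j2 of its bed
VAL = `(vFull p, valSetting p, vRho p, vQDatum p)` (`Repair.CandJoshi23` p437744, `CandJoshi23Tests`, `CandJoshi23Price`,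
`CandJoshi23Profile`): Joshi's valuation law `v ↦ u·v` typed ℚ-linearly on the value line; HONEST volumes (exact `j²`, label-free q,
`|log(q)| > 0`), typed Thm. 3.11, three pins, `BridgeHyps`, the residual S, the typed Corollary (`−|log(Θ)| = 0`) ALL TRUE; Step (x)
admissibility-transport TRUE, Step (x) `LogvolInvariant` FALSE (`val_not_logvolInvariant` — the one failing ∀-form clause).
This file types the cx §A column there (rows comparing the q-pilot with ONE Kummer image / ONE possible image) BY NAME.

FINDINGS (kernel, this file):
* §1 honest volume data of VAL in the shape the cx ceilings consume (`val_thetaRegion_logvol`, `val_thetaRegion3_logvol`,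
  `val_qLocal_neg`, `val_qLocal_indep`, `val_thetaRegionsAdm`).
* §2 the column. KUMMER-image rows — FALSE, by the gen-0 door-(a) ceilings of `Repair.EvalHonestCeiling` fed with VAL's own
  `val_bridgeHyps`: X04a ✗ (`x04_false_val`), C01-VT ✗, C01-GVT ✗, C01-QFC ✗, I17 = I4d′ ✗ (abc-iut-rp-d4's
  `not_hDegreeOrbitGe_of_scaled`), I16 ✓ (`hDegreeOrbit_of_scaled`, `c = 1/PN(j²)`, insufficient as everywhere).
  POSSIBLE-image rows — TRUE for every `ρ`, `qK`: L01 ✓ (`l01_holds_val`), M32a/b/c ✓ (`m32_holds_val`), and J02 ✓ is rp-j2's own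
  `val_joshiVolumeDominance` — because R3 holds at VAL (`CandJoshi23.val_reading3`).
* §3 PACKAGE `val_column_sectionA` with the bed's census BY NAME (`val_profile`, `vFull_statement`, `val_not_logvolInvariant`).

READING for the census (neutral): VAL is a door-(a) bed on which the protocol's honest clauses hold EXCEPT Step (x) `LogvolInvariant`;
its §A column coincides cell for cell with the door-(b) bed SCAL₀'s (cx `EvalScalProfile`, staged): Kummer-image rows FALSE,
possible-image rows TRUE. So the two beds isolate the SAME load-bearing clause of the gen-0 ceilings
`EvalHonestCeilingL01.l01_false_of_honestData` / `CandMochizuki32Tests.no_honest_model_of_H'` /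
`CandJoshi1Barrier.not_joshiVolumeDominance_of_honestAt`: log-volume invariance under the indeterminacies (dropped at VAL by a
non-isometric (Ind2) inside door (a)'s typing, at SCAL₀ by door (b)'s re-typing) — while the Kummer-image rows' clause (exact `j²` on
the Kummer images, `qLocal < 0`) is blind to both. rp-j2's price sheet is CONCURRED with by name: S ✓ ∧ Statement ✓ ∧ BridgeHyps ✓ ∧
ThetaFinite ✓ ∧ ¬LogvolInvariant. No side taken on [IUTchIII] Cor. 3.12, on abc, or on any author (S. Mochizuki, Scholze–Stix,
K. Joshi); candidates are hypotheses, never asserted; model data ≠ intended objects; typed ≠ proved.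
-/

noncomputable section

namespace Summit.ABC.IUTFork.Repair.EvalValProfile

open Thm311 Cor312 Cor312.Checks Cor312.IdentifiedNonVacuity Cor312Vol Cor312Vol.NaiveWitness Cor312Vol.UnitWitness
  Cor312Vol.PinnedWitness Literature.IUT.LogThetaLattice Summit.ABC.IUTFork.Repair Summit.ABC.IUTFork.Repair.ScalarShells
  Summit.ABC.IUTFork.Repair.ScalarShellsThm311 Summit.ABC.IUTFork.Repair.CandJoshi23

variable (p : ℕ)

/-! ## 1. VAL's honest volume data in ceiling shape -/

/-- The cast `(jsq (i+1) : ℚ) = (i+1)²` in `ℝ`. [folklore] -/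
theorem jsq_labelSucc_cast (i : Fin toyIndex.lstar) :
    ((jsq (Setting.labelSucc i) : ℚ) : ℝ) = (((i : ℕ) + 1 : ℕ) : ℝ) ^ 2 := by
  unfold jsq
  rw [show ((Setting.labelSucc i : toyIndex.Label) : ℕ) = (i : ℕ) + 1 from Fin.val_succ i]
  push_cast; ring

/-- **Every Kummer image is honestly scaled at VAL**: `μ(thetaRegion m) = μ(H_{j²}) = j²·qLocal` on `𝔽_l^⋇`, every `m`. [folklore] -/
theorem val_thetaRegion_logvol (m : ℤ) (i : Fin toyIndex.lstar) (vQ : toyIndex.VQ) :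
    ((vFull p).D (valSetting p).n).logvol _ vQ ((valSetting p).thetaRegion m (Setting.labelSucc i) vQ) =
      (((i : ℕ) + 1 : ℕ) : ℝ) ^ 2 * (valSetting p).qLocal (Setting.labelSucc i) vQ := by
  rw [valSetting_thetaRegion, val_qLocal]
  show vVol p _ vQ (vHalf p _ vQ _) = _
  rw [vVol_vHalf, jsq_labelSucc_cast]; ring

/-- … and so is the (Ind3)-enlarged region `thetaRegion3 = H_{j²}`. [folklore] -/
theorem val_thetaRegion3_logvol (i : Fin toyIndex.lstar) (vQ : toyIndex.VQ) :
    ((vFull p).D (valSetting p).n).logvol _ vQ ((valSetting p).thetaRegion3 (Setting.labelSucc i) vQ) =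
      (((i : ℕ) + 1 : ℕ) : ℝ) ^ 2 * (valSetting p).qLocal (Setting.labelSucc i) vQ := by
  rw [valSetting_thetaRegion3, val_qLocal]
  show vVol p _ vQ (vHalf p _ vQ _) = _
  rw [vVol_vHalf, jsq_labelSucc_cast]; ring

/-- The q-volume is label-independent at VAL. [folklore] -/
theorem val_qLocal_indep (i i' : Fin toyIndex.lstar) (vQ : toyIndex.VQ) :
    (valSetting p).qLocal (Setting.labelSucc i) vQ = (valSetting p).qLocal (Setting.labelSucc i') vQ := by
  rw [val_qLocal, val_qLocal]

/-- Every Kummer image is admissible at VAL (a half-line). [folklore] -/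
theorem val_thetaRegionsAdm : ThetaRegionsAdm (valSetting p) := fun m i vQ =>
  ⟨_, valSetting_thetaRegion p m (Setting.labelSucc i) vQ⟩

/-- The Θ-side column volumes are finitely supported at VAL (one place). [folklore] -/
theorem val_thetaAtFinite (m : ℤ) : CandInternal41.ThetaAtFinite (vFull p).toLatticeSituation (valSetting p) m :=
  fun _ => Set.toFinite _

variable [hp : Fact p.Prime]

/-- The q-volume is negative on `𝔽_l^⋇` at VAL. [folklore] -/
theorem val_qLocal_neg (i : Fin toyIndex.lstar) (vQ : toyIndex.VQ) : (valSetting p).qLocal (Setting.labelSucc i) vQ < 0 := by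
  rw [val_qLocal, neg_lt_zero]
  exact log_p_pos p

/-! ## 2. The VAL column of §A -/

/-- **RP-X04a ✗ at VAL** (gen-0 ceiling `x04_false_of_bridgeHyps` fed with `val_bridgeHyps`; directly: `H_1 ⊄ H_4`, rp-j2's
`vHalf_one_not_subset_four`). [folklore] -/
theorem x04_false_val : ¬ CandExplicit4.H (vFull p).toLatticeSituation (valSetting p) :=
  EvalHonestCeiling.x04_false_of_bridgeHyps (vFull p).toLatticeSituation (valSetting p) (val_bridgeHyps p) ⟨1, by decide⟩ le_rfl () (val_thetaRegion3_logvol p _ ())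
    (val_qLocal_neg p _ ())

/-- **RP-C01-VT ✗ at VAL.** [folklore] -/
theorem volumeTransport_false_val : ¬ VolumeTransport (valSetting p) :=
  EvalHonestCeiling.volumeTransport_false_of_bridgeHyps (vFull p).toLatticeSituation (valSetting p) (val_bridgeHyps p) (val_thetaRegionsAdm p) ⟨1, by decide⟩ le_rfl ()
    (val_thetaRegion3_logvol p _ ()) (val_qLocal_neg p _ ())

/-- **RP-C01-GVT ✗ at VAL.** [folklore] -/
theorem globalVolumeTransport_false_val : ¬ GlobalVolumeTransport (valSetting p) :=
  EvalHonestCeiling.globalVolumeTransport_false_of_bridgeHyps (vFull p).toLatticeSituation (valSetting p) (val_bridgeHyps p) (val_thetaRegionsAdm p)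
    (val_thetaRegion3_logvol p) (val_qLocal_indep p) (val_absLogQPos p)

/-- **RP-C01-QFC ✗ at VAL** ((ii)(a) `KummerA` from the bed's typed Thm. 3.11 `vFull_statement`). [folklore] -/
theorem qFrobComparison_false_val : ¬ QFrobComparison (S' := (vFull p).toLatticeSituation) (valSetting p) :=
  EvalHonestCeiling.no_satPlus_qFrobComparison (vFull p) (valSetting p) () (vFull_statement p) (val_bridgeHyps p)
    (val_thetaRegionsAdm p) (val_thetaRegion3_logvol p) (val_qLocal_neg p)

omit hp in
/-- **RP-I16 ✓ at VAL** (`c = 1/PN(j²)`; abc-iut-rp-d4's ∀-form BY NAME). [folklore] -/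
theorem hDegreeOrbit_val : CandInternal41.HDegreeOrbit (vFull p).toLatticeSituation (valSetting p) :=
  CandInternal41Profile.hDegreeOrbit_of_scaled _ _ (val_thetaAtFinite p) (val_thetaRegion_logvol p) (val_qLocal_indep p)

/-- **RP-I17 = I4d′ ✗ at VAL** (d4's ∀-form BY NAME). [folklore] -/
theorem not_hDegreeOrbitGe_val : ¬ CandInternal41.HDegreeOrbitGe (vFull p).toLatticeSituation (valSetting p) :=
  CandInternal41Profile.not_hDegreeOrbitGe_of_scaled _ _ (val_thetaRegion_logvol p) (val_qLocal_indep p) (val_absLogQPos p)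

variable (ρ : (∀ v : toyIndex.V, v ∈ toyIndex.Vbad → Set ((valShells p).StarPacket v)) →
    ∀ (j : toyIndex.Label) (vQ : toyIndex.VQ), Set ((valShells p).Packet j vQ))
  (qK : ∀ v : toyIndex.V, v ∈ toyIndex.Vbad → Set ((valShells p).StarPacket v))

omit hp in
/-- **RP-L01 ✓ at VAL** (every `ρ`, `qK`): R3 at every label (`val_reading3`) gives the global image choice «the q-region everywhere»
of PN-volume exactly `−|log(q)|` (`CandLana1.H_of_reading3`). [folklore] -/
theorem l01_holds_val : CandLana1.H (vFull p).toLatticeSituation (valSetting p) ρ qK :=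
  CandLana1.H_of_reading3 _ _ ρ qK fun _ vQ => val_reading3 p _ vQ

omit hp in
/-- **RP-M32a ✓, M32b ✓, M32c ✓ at VAL** (every `ρ`, `qK`; `CandMochizuki32.H_iff_reading3`, `H'_of_H`, `H''_of_H`). [folklore] -/
theorem m32_holds_val :
    CandMochizuki32.H (vFull p).toLatticeSituation (valSetting p) ρ qK ∧
      CandMochizuki32.H' (vFull p).toLatticeSituation (valSetting p) ρ qK ∧
      CandMochizuki32.H'' (vFull p).toLatticeSituation (valSetting p) ρ qK :=
  have h : CandMochizuki32.H (vFull p).toLatticeSituation (valSetting p) ρ qK :=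
    (CandMochizuki32.H_iff_reading3 _ _ ρ qK).2 fun j vQ => val_reading3 p j vQ
  ⟨h, CandMochizuki32.H'_of_H _ _ ρ qK h, CandMochizuki32.H''_of_H _ _ ρ qK h⟩

/-! ## 3. Package -/

/-- **THE VAL COLUMN OF §A, with the bed's census BY NAME.** Census: typed Thm. 3.11 ✓, three pins ✓, `|log(q)| > 0` ✓, BridgeHyps ✓,
S ✓, Statement ✓ (`−|log(Θ)| = 0`), Step (x) `LogvolInvariant` ✗. Column: Kummer-image rows X04a, C01-VT/GVT/QFC, I17 FALSE;
possible-image rows L01, M32a/b/c, J02 TRUE (I16 TRUE). [folklore] -/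
theorem val_column_sectionA :
    ((vFull p).Statement ∧ PinnedRegions3 (vFull p).toLatticeSituation (valSetting p) (vRho p) (vQDatum p) ∧
      (valSetting p).AbsLogQPos ∧ BridgeHyps (valSetting p) ∧
      PilotKummerIndRelated (vFull p).toLatticeSituation (valSetting p) (vRho p) (vQDatum p) ∧ (valSetting p).Statement ∧
      (valSetting p).negLogTheta = ((0 : ℝ) : WithTop ℝ) ∧ ¬ (vData p).LogvolInvariant) ∧
    (¬ CandExplicit4.H (vFull p).toLatticeSituation (valSetting p) ∧ ¬ VolumeTransport (valSetting p) ∧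
      ¬ GlobalVolumeTransport (valSetting p) ∧ ¬ QFrobComparison (S' := (vFull p).toLatticeSituation) (valSetting p) ∧
      ¬ CandInternal41.HDegreeOrbitGe (vFull p).toLatticeSituation (valSetting p)) ∧
    (CandInternal41.HDegreeOrbit (vFull p).toLatticeSituation (valSetting p) ∧
      CandLana1.H (vFull p).toLatticeSituation (valSetting p) (vRho p) (vQDatum p) ∧
      (CandMochizuki32.H (vFull p).toLatticeSituation (valSetting p) (vRho p) (vQDatum p) ∧
        CandMochizuki32.H' (vFull p).toLatticeSituation (valSetting p) (vRho p) (vQDatum p) ∧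
        CandMochizuki32.H'' (vFull p).toLatticeSituation (valSetting p) (vRho p) (vQDatum p)) ∧
      CandJoshi1.JoshiVolumeDominance (valSetting p)) :=
  ⟨⟨vFull_statement p, val_pinnedRegions3 p, val_absLogQPos p, val_bridgeHyps p, val_residual p, val_statement p,
      val_negLogTheta p, val_not_logvolInvariant p⟩,
    ⟨x04_false_val p, volumeTransport_false_val p, globalVolumeTransport_false_val p, qFrobComparison_false_val p,
      not_hDegreeOrbitGe_val p⟩,
    ⟨hDegreeOrbit_val p, l01_holds_val p _ _, m32_holds_val p _ _, val_joshiVolumeDominance p⟩⟩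

end Summit.ABC.IUTFork.Repair.EvalValProfile

end
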